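import Mathlib.Algebra.CharP.Two
import Mathlib.Algebra.CharP.Lemmas
import Mathlib.LinearAlgebra.Matrix.Symmetric
import Mathlib.LinearAlgebra.Matrix.Determinant.Basic
import Mathlib.Data.Matrix.Block
import Mathlib.RingTheory.MvPolynomial.Basic
import Literature.Computability.AlgebraicComplexity.DeterminantalComplexity
import Literature.Computability.AlgebraicComplexity.ValiantClassesProofs
import HarnessLib

/-!
# Characteristic 2: symmetric determinants are sums over short cycle covers, and the square of the
partial permanent is a projection of the determinant (Grenet–Kaltofen–Koiran–Portier 2011, §5:
Lemma 6, Definition 8, Lemmas 7–8, Theorem 8, Corollary 1, Theorem 9) — typed literature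

B. Grenet, E. L. Kaltofen, P. Koiran, N. Portier, *Symmetric determinantal representation of
formulas and weakly skew circuits*, Contemp. Math. **556** (2011) 61–96 = arXiv:1007.3804v3,
§5 "Characteristic 2" (held text `paper:arxiv-1007.3804`, chunks p0018–p0021; locators below).
Cell `val-lit`, typer t16, DAG row `GKKP11-B` (barrier-side companion of
`Literature/Computability/AlgebraicComplexity/GKKP11SymmetricRepresentations.lean`, which holds
§§1–4 and Prop. 1 of §5.1). Honest framing: typed literature; `VP ≠ VNP` is NOT proved and
nothing here is progress on it.

**Why this is barrier-side.** §5 records what characteristic `2` does to the symmetric /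
permanental dictionary of the `ValiantsHypothesis` ladder: the constructions of §§2–4 need `1/2`
and fail; some polynomials (`xy + z`, hence the `2 × 2` permanent `xw + yz`) have NO symmetric
determinantal representation of any size in characteristic `2` ([GMT], quoted §1.1/§5 — not a
result of this paper, not typed); squares always do (Prop. 1, typed in the companion file); and
the PARTIAL PERMANENT — Bürgisser's candidate `VNP`-complete family in characteristic `2`
(Bürgisser 2000, Problem 3.1) — has its SQUARE in `VP_ws` (Thm. 8), so that its
`VNP`-completeness would put `VNP² ⊆ VP_ws` (Cor. 1) and, over finite fields of characteristic
`2`, collapse `⊕P/poly = NC²/poly` and the polynomial hierarchy (Thm. 9). The tree's catalogue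
entry for "`PER = DET` in characteristic `2`" is `Literature.Barriers.ValiantsHypothesis.CharacteristicTwo`
(`permanentCharTwo_holds`, `not_dcPerSuperpolynomial_of_charTwo`) — CITED, not restated.
Postscript printed at the end of §5 (p0021): "Since the submission of this paper, Bürgisser's open
problem has been completely settled. Guillaume Malod [Mal11] has proved, using clow sequences à la
Mahajan and Vinay, that `PER* ∈ VP_ws`. Stefan Mengel subsequently noticed that the result can be
derived from a result of Valiant on Pfaffian Sums [Val02]" — so the hypothesis of Cor. 1 / Thm. 9
is now believed false for a stronger reason; the implications remain theorems.

## What the source prints and how it is rendered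

* **Lemma 6 (p0019).** "Let `G` be an edge-weighted graph and `A` its adjacency matrix. In
  characteristic `2`, the determinant of `A` is the sum of the weights of the cycle covers with
  cycles of length at most `2`." *Rendering* (as in the companion file: a weighted graph IS its
  symmetric adjacency matrix, a cycle cover IS a permutation `σ`, of weight `∏ᵥ A v (σ v)`; cycles
  of length `≤ 2` ⟺ `σ ∘ σ = id`): for a symmetric matrix over a commutative ring of characteristic
  `2`, `det A = Σ_{σ : σσ = 1} ∏ᵥ A v (σ v)`. PROVED here (`det_eq_sum_involutive_of_charTwo`),
  following the printed proof (reverse the long cycles: `σ ↦ σ⁻¹` pairs off the other terms).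
* **Definition 8 (p0020).** "The partial permanent of `X`, as defined by Bürgisser, is
  `per*(X) = Σ_π ∏_{i ∈ def(π)} X_{iπ(i)}`, where the sum ranges over the injective partial maps
  from `[n]` to `[n]`" and "The family `(PER*_n)` is the family of polynomials such that `PER*_n`
  is the partial permanent of the `(n × n)` matrix whose coefficients are the indeterminates
  `X_{ij}`." = `Matrix.partialPermanent` (a partial map `[n] ⇀ [n]` is a function
  `π : n → Option n`, injective on its domain of definition: `IsPartialInjective`; the empty map
  contributes the empty product `1`) and the family `partialPerPoly n k` (as the tree's `perPoly`:
  the partial permanent of `Matrix.mvPolynomialX n n k`).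
* **Lemma 7 (p0020).** "… the partial permanent of `B` is equal to the sum of the weights of the
  partial matchings of `G`" (complete bipartite graph with biadjacency matrix `B`; "The proof of
  the lemma is quite straightforward as a partial injective map `π` … exactly defines a partial
  matching"). With partial maps rendered as functions `n → Option n` a partial matching IS the
  graph of such a map; the lemma is the identification underlying `Matrix.partialPermanent` and is
  not given a separate name.
* **Lemma 8 (p0020).** "Let `G` be the complete bipartite graph … the edge between `rᵢ` and `cⱼ`
  labelled by `B_{ij}` … Let `A` be its adjacency matrix. Then in characteristic `2`,
  `det(A + I_{2n}) = (per*(B))²`", with (§5, p0018) `A = [[0, B], [Bᵗ, 0]]`. = NAMED FACT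
  `GKKP2011_lemma8` (`Matrix.fromBlocks 0 B Bᵀ 0 + 1` over `n ⊕ n`; any commutative ring of
  characteristic `2` — the printed polynomial identity is the case of the generic `B`, and
  specialises). DISCHARGED at the end of this file (`GKKP2011_lemma8_holds`, following the first
  printed proof: Lemma 6, short covers of the bipartite graph = partial matchings = graphs of
  injective partial maps, each of weight `w(μ)²`, and `Σ w(μ)² = (Σ w(μ))²` in characteristic
  `2`); unconditional forms of Thm. 8 / Cor. 1 follow it.
* **Theorem 8 (p0020).** "In characteristic `2`, the family `((PER*)²_n)` is in `VP_ws`." Printed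
  proof, in full: "The previous lemma shows that the polynomial `(PER*)²_n` is a `p`-projection of
  `DET_{2n}` in characteristic `2`. Thus, `((PER*)²_n)` is in `VP_ws`." The tree has no class
  `VP_ws` (Malod–Portier 2008: polynomial-size weakly-skew circuits; equivalently the
  `p`-projections of `DET`, [MalodPortier2008]/[Toda]); we type the proof's first sentence, which
  is the content: `(PER*_n)²` is a projection of `DET_{2n}` (`IsDetProjection`, single `n`) and
  `((PER*)²_n)` is a `p`-projection of `(DET_n)` (`IsPProjection`, tree `ValiantClasses.lean`) —
  both PROVED here from `GKKP2011_lemma8` (`GKKP2011_thm8_isDetProjection`,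
  `GKKP2011_thm8_isPProjection`).
* **Corollary 1 (p0020).** "In any field of characteristic `2`, if `(PER*_n)` is `VNP`-complete,
  then `VNP² ⊆ VP_ws`" (`VNP² = {(f_n²) : (f_n) ∈ VNP}`). Typed in the same `DET`-projection
  rendering of `VP_ws` (the printed argument: "every `VNP` family `(f_n)` is a `p`-projection of
  `(PER*_n)`, and thus `(f_n²)` is a `p`-projection of `((PER*)²_n)`" + Thm. 8): if `(PER*_n)` is
  `VNP`-complete over a field of characteristic `2` (`IsVNPComplete`, tree) then for every `VNP`
  family `(f_n)` the family `(f_n²)` is a `p`-projection of `(DET_n)` — PROVED from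
  `GKKP2011_lemma8` (`GKKP2011_cor1_detProjection`).
* **Theorem 9 (p0021).** "If the partial permanent family is `VNP`-complete in a finite field of
  characteristic `2`, then `⊕P/poly = NC²/poly`, and the polynomial hierarchy collapses to the
  second level." NOT typed: the Boolean non-uniform classes `⊕P/poly`, `NC²/poly`, `NP/poly` and
  Bürgisser's Boolean parts `BP(·)` are not in the tree (`lean search 'ParityP|NCk|polyAdvice'`:
  no declarations); stating it over abstract class parameters would smuggle content. Recorded here
  with its printed proof skeleton: `BP(VNP) ⊆ BP(VNP²) ⊆ BP(VP)` (Cor. 1), `⊕P/poly = BP(VNP)` and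
  `BP(VP) ⊆ NC²/poly` over finite fields of characteristic `2` (Bürgisser 2000), `NP/poly ⊆ ⊕P/poly`
  (non-uniform Valiant–Vazirani, Bürgisser 2000 Thm. 4.10), Karp–Lipton.

Nothing in this file is a conjecture; the one named fact (`GKKP2011_lemma8`) is a printed, proved
lemma, discharged here (`GKKP2011_lemma8_holds`). Deliberately NOT here: Prop. 1 (companion file, needs the weakly-skew circuit model);
the [GMT] non-representability of `xy + z`; `VP_ws`, `VNP²`, Boolean parts as classes.

## References

* [GrenetEtAl2011] Grenet–Kaltofen–Koiran–Portier, Contemp. Math. 556 (2011) = arXiv:1007.3804,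
  §5: Lemma 6, Prop. 1 (§5.1, p0019–p0020); Def. 8, Lemmas 7–8, Thm. 8, Cor. 1, Thm. 9 (§5.2,
  p0020–p0021).
* [Burgisser2000] P. Bürgisser, *Completeness and Reduction in Algebraic Complexity Theory*,
  Springer 2000: Problem 3.1 (partial permanent), Ch. 4 (Boolean parts; Thm. 4.10).
* [MalodPortier2008] G. Malod, N. Portier, J. Complexity 24 (2008) (`VP_ws`).
* G. Malod, *Succinct algebraic branching programs characterizing non-uniform complexity classes*,
  FCT 2011 (GKKP's [Mal11]: `PER* ∈ VP_ws`), not held.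
* [BurgisserClausenShokrollahi1997] Rem. (21.16)(1) (`PER = DET` in characteristic `2`) via the
  tree's `Literature.Barriers.ValiantsHypothesis.CharacteristicTwo`.
-/

noncomputable section

open MvPolynomial Finset

/-! ## Lemma 6: determinants of symmetric matrices in characteristic 2 -/

namespace Matrix

universe u v w

section Lemma6

variable {R : Type u} [CommRing R] {n : Type v} [Fintype n] [DecidableEq n]

/-- **GKKP 2011, Lemma 6 (§5.1, held text p0019).** "Let `G` be an edge-weighted graph and `A` its
adjacency matrix. In characteristic `2`, the determinant of `A` is the sum of the weights of the
cycle covers with cycles of length at most `2`." For a SYMMETRIC matrix `A` (= adjacency matrix of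
a weighted graph) over a commutative ring of characteristic `2`: `det A = Σ_{σ ∘ σ = 1} ∏ᵥ A v (σ v)`
(a cycle cover is a permutation `σ`, of weight `∏ᵥ A v (σ v)`; its cycles have length `≤ 2` iff
`σσ = 1`; signs are irrelevant in characteristic `2`). Printed proof, followed here: reversing a
cycle of length `≥ 3` (`σ ↦ σ⁻¹`) gives a different cover of the same weight, and the two cancel.
Declared in the `Matrix` namespace as a deliberate dot-notation extension.
[cite: GrenetEtAl2011, Lemma 6] -/
theorem det_eq_sum_involutive_of_charTwo [CharP R 2] {A : Matrix n n R} (hA : A.IsSymm) :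
    A.det = ∑ σ ∈ (univ : Finset (Equiv.Perm n)).filter (fun σ => σ * σ = 1), ∏ i, A i (σ i) := by
  classical
  -- the weight of a cover and its invariance under reversal
  set f : Equiv.Perm n → R := fun σ => ∏ i, A i (σ i) with hf
  have hrev : ∀ σ : Equiv.Perm n, f σ⁻¹ = f σ := by
    intro σ
    simp only [hf]
    calc ∏ i, A i (σ⁻¹ i) = ∏ i, A (σ i) (σ⁻¹ (σ i)) :=
          (Equiv.prod_comp σ (fun i => A i (σ⁻¹ i))).symm
      _ = ∏ i, A (σ i) i := by simp
      _ = ∏ i, A i (σ i) := Finset.prod_congr rfl fun i _ => hA.apply i (σ i)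
  -- Leibniz, with all signs equal to `1` in characteristic `2`
  have hdet : A.det = ∑ σ : Equiv.Perm n, f σ := by
    rw [Matrix.det_apply']
    refine Finset.sum_congr rfl fun σ _ => ?_
    have hsign : ((Equiv.Perm.sign σ : ℤ) : R) = 1 := by
      rcases Int.units_eq_one_or (Equiv.Perm.sign σ) with h | h
      · simp [h]
      · rw [h, Units.val_neg, Units.val_one, Int.cast_neg, Int.cast_one, CharTwo.neg_eq]
    rw [hsign, one_mul]
    exact Finset.prod_congr rfl fun i _ => hA.apply i (σ i)
  rw [hdet, ← Finset.sum_filter_add_sum_filter_not univ (fun σ : Equiv.Perm n => σ * σ = 1) f]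
  -- the covers with a long cycle cancel in pairs `σ, σ⁻¹`
  suffices h0 : ∑ σ ∈ univ.filter (fun σ : Equiv.Perm n => ¬ σ * σ = 1), f σ = 0 by
    rw [h0, add_zero]
  refine Finset.sum_involution (fun σ _ => σ⁻¹) (fun σ _ => ?_) (fun σ hσ _ => ?_)
    (fun σ hσ => ?_) (fun σ _ => inv_inv σ)
  · rw [hrev, ← two_mul, CharTwo.two_eq_zero, zero_mul]
  · have hσ' : ¬ σ * σ = 1 := (Finset.mem_filter.1 hσ).2
    intro h
    exact hσ' (inv_eq_iff_mul_eq_one.1 h)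
  · have hσ' : ¬ σ * σ = 1 := (Finset.mem_filter.1 hσ).2
    refine Finset.mem_filter.2 ⟨Finset.mem_univ _, ?_⟩
    -- `σ⁻¹ σ⁻¹ = (σ σ)⁻¹ = 1` iff `σ σ = 1`
    rw [← mul_inv_rev, inv_eq_one]
    exact hσ'

end Lemma6

/-! ## Definition 8: the partial permanent -/

section Def8

variable {R : Type u} [CommSemiring R] {n : Type v} [Fintype n] [DecidableEq n]

/-- A PARTIAL INJECTIVE MAP `[m] ⇀ [n]` as a function to `Option n` ("recall that a partial map is
a map from a subset of `[n]` to `[n]`", GKKP Def. 8): injective on its domain of definition.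
Reducible, so that it is decidable on finite types by instance search. [cite: GrenetEtAl2011, Def 8] -/
abbrev IsPartialInjective {α : Type v} {β : Type w} (π : α → Option β) : Prop :=
  ∀ (a a' : α) (b : β), π a = some b → π a' = some b → a = a'

/-- **GKKP 2011, Definition 8 (Bürgisser's partial permanent), §5.2, held text p0020.**
"`per*(X) = Σ_π ∏_{i ∈ def(π)} X_{iπ(i)}`, where the sum ranges over the injective partial maps
from `[n]` to `[n]` and `def(π)` is the domain of the partial map `π`." Here for a matrix with
rows `m` and columns `n` (Bürgisser's case is square); the nowhere-defined map contributes the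
empty product `1`. By Lemma 7 (p0020) this is the sum of the weights of the partial matchings of
the complete bipartite graph with biadjacency matrix `B`. Declared in the `Matrix` namespace next
to `Matrix.permanent` (deliberate dot-notation extension). [cite: GrenetEtAl2011, Def 8] -/
def partialPermanent {m : Type w} [Fintype m] [DecidableEq m] (B : Matrix m n R) : R :=
  ∑ π ∈ (univ : Finset (m → Option n)).filter (fun π => IsPartialInjective π),
    ∏ i, (π i).elim 1 (B i)

end Def8

end Matrix

namespace Literature.Barriers.ValiantsHypothesis

open Literature.Computability.AlgebraicComplexity Matrix

universe u

/-- **The family `(PER*_n)` (GKKP Def. 8, p0020):** "the family of polynomials such that `PER*_n`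
is the partial permanent of the `(n × n)` matrix whose coefficients are the indeterminates
`X_{ij}`" — the partial permanent of the generic matrix `Matrix.mvPolynomialX n n k`, in the
`n²` variables `X (i, j)` (as the tree's `perPoly`, `StandardFamilies.lean`).
[cite: GrenetEtAl2011, Def 8] -/
def partialPerPoly (n : Type) [Fintype n] [DecidableEq n] (k : Type u) [CommSemiring k] :
    MvPolynomial (n × n) k :=
  (Matrix.mvPolynomialX n n k).partialPermanent

/-- Unfolding of `PER*_n`. [cite: GrenetEtAl2011, Def 8] -/
theorem partialPerPoly_def (n : Type) [Fintype n] [DecidableEq n] (k : Type u) [CommSemiring k] :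
    partialPerPoly n k = (Matrix.mvPolynomialX n n k).partialPermanent := rfl

/-- Sanity: for `n = ∅` the only partial map is the empty one, `PER*_0 = 1`.
[cite: GrenetEtAl2011, Def 8] -/
theorem partialPerPoly_of_isEmpty (n : Type) [Fintype n] [DecidableEq n] [IsEmpty n] (k : Type u)
    [CommSemiring k] : partialPerPoly n k = 1 := by
  unfold partialPerPoly Matrix.partialPermanent
  have huniq : ∀ π : n → Option n, π = fun i => isEmptyElim i := fun π => funext fun i => isEmptyElim i
  rw [Finset.sum_eq_single (fun i => isEmptyElim i)]
  · simp
  · intro π _ hπ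
    exact absurd (huniq π) hπ
  · intro h
    exact absurd (Finset.mem_filter.2 ⟨Finset.mem_univ _, fun a => isEmptyElim a⟩) h

/-! ## Lemma 8 (named fact) and Theorem 8, Corollary 1 (proved from it) -/

/-- **GKKP 2011, Lemma 8, §5.2, held text p0020.** "Let `G` be the complete bipartite graph with
two independent sets of vertices `V_r` and `V_c` such that the edge between `rᵢ` and `cⱼ` is
labelled by `B_{ij}` (the matrix `B` is the biadjacency matrix of `G`). Let `A` be its adjacency
matrix. Then in characteristic `2`, `det(A + I_{2n}) = (per*(B))²`, where `I_{2n}` is the identity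
matrix of dimensions `2n`." With `A = [[0, B], [Bᵗ, 0]]` (p0018) on the vertex set `n ⊕ n`;
over any commutative ring of characteristic `2` (the printed identity for the generic `B`
specialises, and conversely is the case `R = 𝔽₂[X_{ij}]`). Named fact (D-0014), dischargeable by
either printed proof (Lemma 6 + partial matchings; or `per(A + tI)` via central minors).
[cite: GrenetEtAl2011, Lemma 8] -/
def GKKP2011_lemma8 : Prop :=
  ∀ (R : Type) [CommRing R] [CharP R 2] (n : Type) [Fintype n] [DecidableEq n] (B : Matrix n n R),
    (Matrix.fromBlocks 0 B Bᵀ 0 + 1).det = B.partialPermanent ^ 2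

/-- The matrix `A + I_{2n}` of Lemma 8 for the GENERIC `B = (X_{ij})`: entries are variables
`X (i, j)` (off-diagonal blocks) or the constants `0, 1` (diagonal blocks = identity), i.e. it is a
projection matrix in Valiant's sense. [cite: GrenetEtAl2011, Thm 8 (proof)] -/
theorem lemma8Matrix_entry (k : Type u) [CommRing k] (n : Type) [Fintype n] [DecidableEq n]
    (v w : n ⊕ n) :
    (∃ ij : n × n, (Matrix.fromBlocks 0 (Matrix.mvPolynomialX n n k) (Matrix.mvPolynomialX n n k)ᵀ 0
        + 1) v w = X ij) ∨
      ∃ c : k, (Matrix.fromBlocks 0 (Matrix.mvPolynomialX n n k) (Matrix.mvPolynomialX n n k)ᵀ 0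
        + 1) v w = C c := by
  rcases v with i | j <;> rcases w with i' | j'
  · refine Or.inr ?_
    by_cases h : i = i'
    · exact ⟨1, by simp [h]⟩
    · exact ⟨0, by simp [h]⟩
  · exact Or.inl ⟨(i, j'), by simp [Matrix.mvPolynomialX_apply]⟩
  · exact Or.inl ⟨(i', j), by simp [Matrix.mvPolynomialX_apply]⟩
  · refine Or.inr ?_
    by_cases h : j = j'
    · exact ⟨1, by simp [h]⟩
    · exact ⟨0, by simp [h]⟩

/-- **GKKP 2011, Theorem 8 (§5.2, held text p0020), projection form for one `n`.** Printed:
"In characteristic `2`, the family `((PER*)²_n)` is in `VP_ws`. Proof. The previous lemma shows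
that the polynomial `(PER*)²_n` is a `p`-projection of `DET_{2n}` in characteristic `2`." Typed
(the tree has no `VP_ws`): over a field of characteristic `2`, `(PER*_n)²` is a projection of
`DET_{2n}` (`IsDetProjection`), from the fact `GKKP2011_lemma8`. [cite: GrenetEtAl2011, Thm 8] -/
theorem GKKP2011_thm8_isDetProjection (h : GKKP2011_lemma8) (k : Type) [Field k] [CharP k 2]
    (n : ℕ) : IsDetProjection (partialPerPoly (Fin n) k ^ 2) (2 * n) := by
  classical
  -- the matrix `A + I` for the generic `B`, reindexed along `Fin n ⊕ Fin n ≃ Fin (2n)`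
  set Xn : Matrix (Fin n) (Fin n) (MvPolynomial (Fin n × Fin n) k) :=
    Matrix.mvPolynomialX (Fin n) (Fin n) k with hXn
  set M : Matrix (Fin n ⊕ Fin n) (Fin n ⊕ Fin n) (MvPolynomial (Fin n × Fin n) k) :=
    Matrix.fromBlocks 0 Xn Xnᵀ 0 + 1 with hM
  let e : Fin n ⊕ Fin n ≃ Fin (2 * n) := finSumFinEquiv.trans (finCongr (two_mul n).symm)
  refine ⟨fun pq => M (e.symm pq.1) (e.symm pq.2), fun pq => ?_, ?_⟩
  · simpa [hM, hXn] using lemma8Matrix_entry k (Fin n) (e.symm pq.1) (e.symm pq.2)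
  · -- `aeval a DET_{2n} = det (M.submatrix e⁻¹ e⁻¹) = det M = (PER*_n)²`
    rw [detPoly, AlgHom.map_det]
    have hmap : (AlgHom.mapMatrix (aeval fun pq : Fin (2 * n) × Fin (2 * n) =>
          M (e.symm pq.1) (e.symm pq.2)))
        (Matrix.mvPolynomialX (Fin (2 * n)) (Fin (2 * n)) k) = M.submatrix e.symm e.symm := by
      ext p q
      simp [Matrix.mvPolynomialX_apply]
    rw [hmap, Matrix.det_submatrix_equiv_self, hM, h, hXn, partialPerPoly]

/-- **GKKP 2011, Theorem 8, family form.** `((PER*)²_n)_n` is a `p`-projection of `(DET_n)_n`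
(with `t(n) = 2n`) over a field of characteristic `2` — the tree's `IsPProjection`
(`ValiantClasses.lean`); printed conclusion "is in `VP_ws`" (= `p`-projections of `DET`,
Malod–Portier), class not in tree. From the fact `GKKP2011_lemma8`. [cite: GrenetEtAl2011, Thm 8] -/
theorem GKKP2011_thm8_isPProjection (h : GKKP2011_lemma8) (k : Type) [Field k] [CharP k 2] :
    IsPProjection (fun n => partialPerPoly (Fin n) k ^ 2) (fun n => detPoly (Fin n) k) := by
  refine ⟨fun n => 2 * n, ⟨2, fun n => ?_⟩, fun n => GKKP2011_thm8_isDetProjection h k n⟩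
  show 2 * n ≤ n ^ 2 + 2
  rcases Nat.lt_or_ge n 2 with hn | hn
  · interval_cases n <;> norm_num
  · calc 2 * n ≤ n * n := Nat.mul_le_mul_right n hn
      _ ≤ n ^ 2 + 2 := by rw [sq]; exact Nat.le_add_right _ _

/-- Squares of projections are projections of squares (`aeval` is a ring map). [cite: GrenetEtAl2011, Cor 1 (proof)] -/
theorem isProjection_sq_of_isProjection {k : Type u} [CommSemiring k] {σ τ : Type}
    {g : MvPolynomial τ k} {f : MvPolynomial σ k} (h : IsProjection g f) :
    IsProjection (g ^ 2) (f ^ 2) := by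
  obtain ⟨a, ha, rfl⟩ := h
  exact ⟨a, ha, (map_pow _ _ _).symm⟩

/-- **GKKP 2011, Corollary 1 (§5.2, held text p0020), `DET`-projection form.** Printed: "In any
field of characteristic `2`, if `(PER*_n)` is `VNP`-complete, then `VNP² ⊆ VP_ws`" (argument:
"every `VNP` family `(f_n)` is a `p`-projection of `(PER*_n)`, and thus `(f_n²)` is a
`p`-projection of `((PER*)²_n)`", then Thm. 8). Typed with `VP_ws` read as "`p`-projections of
`DET`" (Malod–Portier; class not in tree): if `(PER*_n)` is `VNP`-complete (`IsVNPComplete`) over a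
field of characteristic `2`, then for every `VNP` family `(f_n)` (variables `Fin (v n)`, as in
`IsVNPComplete`) the family `(f_n²)` is a `p`-projection of `(DET_n)`. Proved from the fact
`GKKP2011_lemma8` via Thm. 8 and transitivity of `p`-projections (`IsPProjection.trans_holds`).
[cite: GrenetEtAl2011, Cor 1] -/
theorem GKKP2011_cor1_detProjection (h : GKKP2011_lemma8) (k : Type) [Field k] [CharP k 2]
    (hc : IsVNPComplete fun n => partialPerPoly (Fin n) k) (v : ℕ → ℕ)
    (f : ∀ n, MvPolynomial (Fin (v n)) k) (hf : IsVNPFamily f) :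
    IsPProjection (fun n => f n ^ 2) (fun n => detPoly (Fin n) k) := by
  obtain ⟨t, ht, hproj⟩ := hc.2 v f hf
  have hsq : IsPProjection (fun n => f n ^ 2) (fun n => partialPerPoly (Fin n) k ^ 2) :=
    ⟨t, ht, fun n => isProjection_sq_of_isProjection (hproj n)⟩
  exact IsPProjection.trans_holds hsq (GKKP2011_thm8_isPProjection h k)

end Literature.Barriers.ValiantsHypothesis

/-! ## Discharge of `GKKP2011_lemma8` (printed proof via Lemma 6 and partial matchings) -/

namespace Literature.Barriers.ValiantsHypothesis

namespace GKKP2011Lemma8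

open Literature.Computability.AlgebraicComplexity Matrix

universe u

variable {R : Type u} [CommRing R] {n : Type} [DecidableEq n]

/-- GKKP's matrix `A + I_{2n}`, `A = [[0, B], [Bᵗ, 0]]` the adjacency matrix of the complete
bipartite graph weighted by `B`, loops of weight `1` added (proof of Lemma 8: "the graph `G'`
obtained from `G` by adding weight-`1` loops on all its vertices"). [cite: GrenetEtAl2011, Lemma 8 (proof)] -/
def adjPlusOne (B : Matrix n n R) : Matrix (n ⊕ n) (n ⊕ n) R := Matrix.fromBlocks 0 B Bᵀ 0 + 1

/-- Entries of `A + I`: row side to row side is the identity. [cite: GrenetEtAl2011, Lemma 8 (proof)] -/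
@[simp] theorem adjPlusOne_inl_inl (B : Matrix n n R) (i i' : n) :
    adjPlusOne B (Sum.inl i) (Sum.inl i') = if i = i' then 1 else 0 := by
  simp [adjPlusOne, Matrix.one_apply]

/-- Entries of `A + I`: row `i` to column `j` is `B i j`. [cite: GrenetEtAl2011, Lemma 8 (proof)] -/
@[simp] theorem adjPlusOne_inl_inr (B : Matrix n n R) (i j : n) :
    adjPlusOne B (Sum.inl i) (Sum.inr j) = B i j := by
  simp [adjPlusOne]

/-- Entries of `A + I`: column `j` to row `i` is `B i j`. [cite: GrenetEtAl2011, Lemma 8 (proof)] -/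
@[simp] theorem adjPlusOne_inr_inl (B : Matrix n n R) (j i : n) :
    adjPlusOne B (Sum.inr j) (Sum.inl i) = B i j := by
  simp [adjPlusOne]

/-- Entries of `A + I`: column side to column side is the identity. [cite: GrenetEtAl2011, Lemma 8 (proof)] -/
@[simp] theorem adjPlusOne_inr_inr (B : Matrix n n R) (j j' : n) :
    adjPlusOne B (Sum.inr j) (Sum.inr j') = if j = j' then 1 else 0 := by
  simp [adjPlusOne, Matrix.one_apply]

/-- `A + I` is symmetric (it is the adjacency matrix of a graph). [cite: GrenetEtAl2011, Lemma 8 (proof)] -/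
theorem isSymm_adjPlusOne (B : Matrix n n R) : (adjPlusOne B).IsSymm :=
  Matrix.IsSymm.add (Matrix.IsSymm.fromBlocks (by simp [Matrix.IsSymm]) rfl (by simp [Matrix.IsSymm]))
    Matrix.isSymm_one

/-- The edge weight picked up at row `i`, column `j` by the cover `σ`: `B i j` if `σ` matches
`rᵢ` with `cⱼ`, else `1`. [cite: GrenetEtAl2011, Lemma 8 (proof)] -/
def edgeWt (B : Matrix n n R) (σ : Equiv.Perm (n ⊕ n)) (i j : n) : R :=
  if σ (Sum.inl i) = Sum.inr j then B i j else 1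

/-- A cover with cycles of length `≤ 2` of the BIPARTITE graph `G'`: every moved vertex changes
side ("a cycle cover with such cycles actually is a partial matching", proof of Lemma 8).
Reducible for decidability. [cite: GrenetEtAl2011, Lemma 8 (proof)] -/
abbrev IsCrossing (σ : Equiv.Perm (n ⊕ n)) : Prop := ∀ v : n ⊕ n, σ v = v ∨ (σ v).isLeft ≠ v.isLeft

/-- The partial injective map (partial matching) of a cover: `rᵢ ↦ cⱼ` when `σ (rᵢ) = cⱼ`.
[cite: GrenetEtAl2011, Lemma 8 (proof)] -/
def toPartial (σ : Equiv.Perm (n ⊕ n)) : n → Option n := fun i => (σ (Sum.inl i)).getRight?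

omit [DecidableEq n] in
/-- The partial map of a cover is injective on its domain. [cite: GrenetEtAl2011, Lemma 8 (proof)] -/
theorem isPartialInjective_toPartial (σ : Equiv.Perm (n ⊕ n)) : IsPartialInjective (toPartial σ) := by
  intro a a' b ha ha'
  simp only [toPartial, Sum.getRight?_eq_some_iff] at ha ha'
  exact Sum.inl_injective (σ.injective (ha.trans ha'.symm))

variable [Fintype n]

/-- The weight of the cycle cover `σ` of the graph `G'`. [cite: GrenetEtAl2011, Lemma 8 (proof)] -/
def weight (B : Matrix n n R) (σ : Equiv.Perm (n ⊕ n)) : R := ∏ v, adjPlusOne B v (σ v)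

/-- The weight of a partial map `π` in `per*(B)`: `∏_{i ∈ def(π)} B i π(i)`. [cite: GrenetEtAl2011, Def 8] -/
def mapWt (B : Matrix n n R) (π : n → Option n) : R := ∏ i, (π i).elim 1 (B i)

/-- Unfolding of `per*` through `mapWt`. [cite: GrenetEtAl2011, Def 8] -/
theorem partialPermanent_eq (B : Matrix n n R) :
    B.partialPermanent = ∑ π ∈ (univ : Finset (n → Option n)).filter (fun π => IsPartialInjective π),
      mapWt B π := rfl

/-- Row factor of the weight of a crossing cover = product of its edge weights.
[cite: GrenetEtAl2011, Lemma 8 (proof)] -/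
theorem prod_inl_eq (B : Matrix n n R) {σ : Equiv.Perm (n ⊕ n)} (hc : IsCrossing σ) :
    ∏ i, adjPlusOne B (Sum.inl i) (σ (Sum.inl i)) = ∏ i, ∏ j, edgeWt B σ i j := by
  refine Finset.prod_congr rfl fun i _ => ?_
  unfold edgeWt
  rcases h : σ (Sum.inl i) with i' | j₀
  · -- a row vertex sent to a row vertex is fixed
    have hfix : i' = i := by
      rcases hc (Sum.inl i) with h1 | h1
      · rw [h] at h1; exact Sum.inl_injective h1
      · rw [h] at h1; exact absurd rfl h1
    rw [hfix]
    simp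
  · simp [Finset.prod_ite_eq]

/-- Column factor of the weight of a crossing short cover = the same product of edge weights.
[cite: GrenetEtAl2011, Lemma 8 (proof)] -/
theorem prod_inr_eq (B : Matrix n n R) {σ : Equiv.Perm (n ⊕ n)} (hσ : ∀ v, σ (σ v) = v)
    (hc : IsCrossing σ) :
    ∏ j, adjPlusOne B (Sum.inr j) (σ (Sum.inr j)) = ∏ j, ∏ i, edgeWt B σ i j := by
  refine Finset.prod_congr rfl fun j _ => ?_
  unfold edgeWt
  rcases h : σ (Sum.inr j) with i₀ | j'
  · -- `σ cⱼ = r_{i₀}`: the only row matched with `cⱼ` is `i₀`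
    have hiff : ∀ i, (σ (Sum.inl i) = Sum.inr j) ↔ i = i₀ := by
      intro i
      constructor
      · intro hi
        have := hσ (Sum.inl i)
        rw [hi, h] at this
        exact Sum.inl_injective this.symm
      · rintro rfl
        have := hσ (Sum.inr j)
        rwa [h] at this
    rw [adjPlusOne_inr_inl]
    rw [Finset.prod_congr rfl (fun i _ => show (if σ (Sum.inl i) = Sum.inr j then B i j else 1) =
        (if i = i₀ then B i j else 1) from by simp only [hiff])]
    simp [Finset.prod_ite_eq']
  · -- `σ cⱼ` a column vertex: `cⱼ` is fixed and matched with no row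
    have hfix : j' = j := by
      rcases hc (Sum.inr j) with h1 | h1
      · rw [h] at h1; exact Sum.inr_injective h1
      · rw [h] at h1; exact absurd rfl h1
    rw [hfix] at h ⊢
    have hnone : ∀ i, σ (Sum.inl i) ≠ Sum.inr j := by
      intro i hi
      have := hσ (Sum.inl i)
      rw [hi, h] at this
      exact Sum.inr_ne_inl this
    simp [hnone]

/-- The weight of a crossing short cover is the SQUARE of the weight of its partial matching ("the
weight of the cycle cover is the square of the weight of the perfect matching … each edge
contributes twice to the product"). [cite: GrenetEtAl2011, Lemma 8 (proof)] -/
theorem weight_eq_sq (B : Matrix n n R) {σ : Equiv.Perm (n ⊕ n)} (hσ : ∀ v, σ (σ v) = v)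
    (hc : IsCrossing σ) : weight B σ = (∏ i, ∏ j, edgeWt B σ i j) ^ 2 := by
  rw [weight, Fintype.prod_sum_type, prod_inl_eq B hc, prod_inr_eq B hσ hc, Finset.prod_comm, sq]

/-- The weight of the partial map of a cover is the product of the cover's edge weights.
[cite: GrenetEtAl2011, Lemma 8 (proof)] -/
theorem mapWt_toPartial (B : Matrix n n R) (σ : Equiv.Perm (n ⊕ n)) :
    mapWt B (toPartial σ) = ∏ i, ∏ j, edgeWt B σ i j := by
  refine Finset.prod_congr rfl fun i _ => ?_
  unfold edgeWt toPartial
  rcases h : σ (Sum.inl i) with i' | j₀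
  · simp
  · simp [Finset.prod_ite_eq]

/-- A short cover with a same-side `2`-cycle uses a non-edge of the bipartite graph: weight `0`.
[cite: GrenetEtAl2011, Lemma 8 (proof)] -/
theorem weight_eq_zero (B : Matrix n n R) {σ : Equiv.Perm (n ⊕ n)} (hc : ¬ IsCrossing σ) :
    weight B σ = 0 := by
  unfold IsCrossing at hc
  push Not at hc
  obtain ⟨v, hv, hside⟩ := hc
  refine Finset.prod_eq_zero (Finset.mem_univ v) ?_
  rcases v with i | j
  · rcases h : σ (Sum.inl i) with i' | j₀
    · have hne : i ≠ i' := fun hii => hv (by rw [h, hii])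
      simp [hne]
    · rw [h] at hside; exact absurd hside (by simp)
  · rcases h : σ (Sum.inr j) with i₀ | j'
    · rw [h] at hside; exact absurd hside (by simp)
    · have hne : j ≠ j' := fun hjj => hv (by rw [h, hjj])
      simp [hne]

/-- The cover (involution of `V_r ⊔ V_c`) defined by a partial map: `rᵢ ↔ c_{π i}` on `def(π)`,
everything else fixed ("Conversely, suppose that `G'` has a perfect matching …", here for partial
matchings). [cite: GrenetEtAl2011, Lemma 8 (proof)] -/
def matchFun (π : n → Option n) : n ⊕ n → n ⊕ n
  | Sum.inl i => (π i).elim (Sum.inl i) Sum.inr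
  | Sum.inr j => if h : ∃ i, π i = some j then Sum.inl h.choose else Sum.inr j

/-- `matchFun π` on a row vertex in the domain. [cite: GrenetEtAl2011, Lemma 8 (proof)] -/
theorem matchFun_inl_of_some {π : n → Option n} {i j : n} (h : π i = some j) :
    matchFun π (Sum.inl i) = Sum.inr j := by
  simp [matchFun, h]

/-- `matchFun π` on a row vertex outside the domain. [cite: GrenetEtAl2011, Lemma 8 (proof)] -/
theorem matchFun_inl_of_none {π : n → Option n} {i : n} (h : π i = none) :
    matchFun π (Sum.inl i) = Sum.inl i := by
  simp [matchFun, h]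

/-- `matchFun π` on a column vertex in the range (for `π` injective). [cite: GrenetEtAl2011, Lemma 8 (proof)] -/
theorem matchFun_inr_of_some {π : n → Option n} (hπ : IsPartialInjective π) {i j : n}
    (h : π i = some j) : matchFun π (Sum.inr j) = Sum.inl i := by
  have hex : ∃ i, π i = some j := ⟨i, h⟩
  simp only [matchFun, hex, ↓reduceDIte, Sum.inl.injEq]
  exact hπ _ _ j hex.choose_spec h

/-- `matchFun π` on a column vertex outside the range. [cite: GrenetEtAl2011, Lemma 8 (proof)] -/
theorem matchFun_inr_of_none {π : n → Option n} {j : n} (h : ∀ i, π i ≠ some j) :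
    matchFun π (Sum.inr j) = Sum.inr j := by
  have hex : ¬ ∃ i, π i = some j := fun ⟨i, hi⟩ => h i hi
  simp [matchFun, hex]

/-- `matchFun π` is an involution for `π` injective. [cite: GrenetEtAl2011, Lemma 8 (proof)] -/
theorem matchFun_involutive {π : n → Option n} (hπ : IsPartialInjective π) :
    Function.Involutive (matchFun π) := by
  intro v
  rcases v with i | j
  · rcases h : π i with _ | j
    · rw [matchFun_inl_of_none h, matchFun_inl_of_none h]
    · rw [matchFun_inl_of_some h, matchFun_inr_of_some hπ h]
  · by_cases hex : ∃ i, π i = some j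
    · obtain ⟨i, hi⟩ := hex
      rw [matchFun_inr_of_some hπ hi, matchFun_inl_of_some hi]
    · have h : ∀ i, π i ≠ some j := fun i hi => hex ⟨i, hi⟩
      rw [matchFun_inr_of_none h, matchFun_inr_of_none h]

/-- The cover of a partial map, as a permutation (identity when `π` is not injective — unused
junk value). [cite: GrenetEtAl2011, Lemma 8 (proof)] -/
def ofPartial (π : n → Option n) : Equiv.Perm (n ⊕ n) :=
  if hπ : IsPartialInjective π then (matchFun_involutive hπ).toPerm _ else 1

/-- `ofPartial π` acts by `matchFun π`. [cite: GrenetEtAl2011, Lemma 8 (proof)] -/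
theorem ofPartial_apply {π : n → Option n} (hπ : IsPartialInjective π) (v : n ⊕ n) :
    ofPartial π v = matchFun π v := by
  rw [ofPartial, dif_pos hπ]
  rfl

/-- **Discharge of `GKKP2011_lemma8`** (D-0014), following the printed proof: Lemma 6 reduces
`det(A + I)` in characteristic `2` to the covers with cycles of length `≤ 2` (involutions); those
using a non-edge of the bipartite graph weigh `0`, the others are exactly the partial matchings
`μ` (= graphs of injective partial maps), each of weight `w(μ)²`; and `Σ w(μ)² = (Σ w(μ))²` in
characteristic `2`. [cite: GrenetEtAl2011, Lemma 8] -/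
theorem lemma8_holds : GKKP2011_lemma8 := by
  intro R _ _ n _ _ B
  classical
  change (adjPlusOne B).det = _
  rw [Matrix.det_eq_sum_involutive_of_charTwo (isSymm_adjPlusOne B), partialPermanent_eq,
    CharTwo.sum_sq]
  -- keep only the crossing covers (the others weigh `0`)
  set S := (univ : Finset (Equiv.Perm (n ⊕ n))).filter (fun σ => σ * σ = 1) with hS
  set IC := S.filter (fun σ => IsCrossing σ) with hIC
  set PI := (univ : Finset (n → Option n)).filter (fun π => IsPartialInjective π) with hPI
  have hinv : ∀ σ ∈ S, ∀ v, σ (σ v) = v := fun σ hσ v => by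
    have h := (Finset.mem_filter.1 hσ).2
    have := congrArg (fun τ : Equiv.Perm (n ⊕ n) => τ v) h
    simpa using this
  have step1 : ∑ σ ∈ S, ∏ v, adjPlusOne B v (σ v) = ∑ σ ∈ IC, weight B σ := by
    rw [hIC]
    refine (Finset.sum_subset (Finset.filter_subset _ S) fun σ hσS hσIC => ?_).symm
    have hc : ¬ IsCrossing σ := fun hc => hσIC (Finset.mem_filter.2 ⟨hσS, hc⟩)
    exact weight_eq_zero B hc
  rw [step1]
  -- reindex the crossing short covers by their partial matchings
  refine Finset.sum_nbij' toPartial ofPartial (fun σ _ => ?_) (fun π hπ => ?_) (fun σ hσ => ?_)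
    (fun π hπ => ?_) (fun σ hσ => ?_)
  · -- `toPartial σ` is an injective partial map
    exact Finset.mem_filter.2 ⟨Finset.mem_univ _, isPartialInjective_toPartial σ⟩
  · -- `ofPartial π` is a crossing involution
    have hπ' : IsPartialInjective π := (Finset.mem_filter.1 hπ).2
    refine Finset.mem_filter.2 ⟨Finset.mem_filter.2 ⟨Finset.mem_univ _, ?_⟩, fun v => ?_⟩
    · ext v
      simp [ofPartial_apply hπ', matchFun_involutive hπ' v]
    · rw [ofPartial_apply hπ']
      rcases v with i | j
      · rcases h : π i with _ | j
        · exact Or.inl (matchFun_inl_of_none h)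
        · exact Or.inr (by rw [matchFun_inl_of_some h]; simp)
      · by_cases hex : ∃ i, π i = some j
        · obtain ⟨i, hi⟩ := hex
          exact Or.inr (by rw [matchFun_inr_of_some hπ' hi]; simp)
        · exact Or.inl (matchFun_inr_of_none fun i hi => hex ⟨i, hi⟩)
  · -- `ofPartial (toPartial σ) = σ`
    have hσS : σ ∈ S := (Finset.mem_filter.1 hσ).1
    have hc : IsCrossing σ := (Finset.mem_filter.1 hσ).2
    have hπ' := isPartialInjective_toPartial σ
    ext v
    rw [ofPartial_apply hπ']
    rcases v with i | j
    · rcases h : σ (Sum.inl i) with i' | j₀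
      · have hfix : i' = i := by
          rcases hc (Sum.inl i) with h1 | h1
          · rw [h] at h1; exact Sum.inl_injective h1
          · rw [h] at h1; exact absurd rfl h1
        rw [hfix] at h ⊢
        rw [matchFun_inl_of_none (π := toPartial σ) (i := i) (by simp [toPartial, h])]
      · rw [matchFun_inl_of_some (π := toPartial σ) (i := i) (j := j₀) (by simp [toPartial, h])]
    · rcases h : σ (Sum.inr j) with i₀ | j'
      · have hi₀ : toPartial σ i₀ = some j := by
          have := hinv σ hσS (Sum.inr j)
          rw [h] at this
          simp [toPartial, this]
        rw [matchFun_inr_of_some hπ' hi₀]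
      · have hfix : j' = j := by
          rcases hc (Sum.inr j) with h1 | h1
          · rw [h] at h1; exact Sum.inr_injective h1
          · rw [h] at h1; exact absurd rfl h1
        rw [hfix] at h ⊢
        refine matchFun_inr_of_none fun i hi => ?_
        simp only [toPartial, Sum.getRight?_eq_some_iff] at hi
        have := hinv σ hσS (Sum.inl i)
        rw [hi, h] at this
        exact Sum.inr_ne_inl this
  · -- `toPartial (ofPartial π) = π`
    have hπ' : IsPartialInjective π := (Finset.mem_filter.1 hπ).2
    funext i
    simp only [toPartial, ofPartial_apply hπ']
    rcases h : π i with _ | j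
    · rw [matchFun_inl_of_none h]; simp
    · rw [matchFun_inl_of_some h]; simp
  · -- weights: `w(σ) = w(μ_σ)²`
    have hσS : σ ∈ S := (Finset.mem_filter.1 hσ).1
    have hc : IsCrossing σ := (Finset.mem_filter.1 hσ).2
    rw [weight_eq_sq B (hinv σ hσS) hc, mapWt_toPartial]

end GKKP2011Lemma8

open Literature.Computability.AlgebraicComplexity

/-- **GKKP 2011, Lemma 8 — discharged** (D-0014): `det([[0,B],[Bᵗ,0]] + I) = (per* B)²` over
every commutative ring of characteristic `2`. [cite: GrenetEtAl2011, Lemma 8] -/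
theorem GKKP2011_lemma8_holds : GKKP2011_lemma8 := GKKP2011Lemma8.lemma8_holds

/-- **GKKP 2011, Theorem 8, unconditional** (projection form, see `GKKP2011_thm8_isDetProjection`):
over a field of characteristic `2`, `(PER*_n)²` is a projection of `DET_{2n}`.
[cite: GrenetEtAl2011, Thm 8] -/
theorem isDetProjection_partialPerPoly_sq (k : Type) [Field k] [CharP k 2] (n : ℕ) :
    IsDetProjection (partialPerPoly (Fin n) k ^ 2) (2 * n) :=
  GKKP2011_thm8_isDetProjection GKKP2011_lemma8_holds k n

/-- **GKKP 2011, Theorem 8, unconditional** (family form, see `GKKP2011_thm8_isPProjection`):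
`((PER*)²_n)` is a `p`-projection of `(DET_n)` over a field of characteristic `2` (printed: "is
in `VP_ws`"). [cite: GrenetEtAl2011, Thm 8] -/
theorem isPProjection_partialPerPoly_sq (k : Type) [Field k] [CharP k 2] :
    IsPProjection (fun n => partialPerPoly (Fin n) k ^ 2) (fun n => detPoly (Fin n) k) :=
  GKKP2011_thm8_isPProjection GKKP2011_lemma8_holds k

/-- **GKKP 2011, Corollary 1, unconditional** (`DET`-projection form, see
`GKKP2011_cor1_detProjection`): over a field of characteristic `2`, if `(PER*_n)` is
`VNP`-complete then every `VNP` family has its square a `p`-projection of `(DET_n)` (printed: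
"`VNP² ⊆ VP_ws`"). [cite: GrenetEtAl2011, Cor 1] -/
theorem isPProjection_sq_detPoly_of_isVNPComplete_partialPerPoly (k : Type) [Field k] [CharP k 2]
    (hc : IsVNPComplete fun n => partialPerPoly (Fin n) k) (v : ℕ → ℕ)
    (f : ∀ n, MvPolynomial (Fin (v n)) k) (hf : IsVNPFamily f) :
    IsPProjection (fun n => f n ^ 2) (fun n => detPoly (Fin n) k) :=
  GKKP2011_cor1_detProjection GKKP2011_lemma8_holds k hc v f hf

end Literature.Barriers.ValiantsHypothesis

end
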